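import Summits.RiemannHypothesis.RiemannHypothesis.Theorems.PfPersistenceTransport
import Summits.RiemannHypothesis.RiemannHypothesis.Theorems.WeilWindowFlowDiniLeakageCalibration
import Summits.RiemannHypothesis.RiemannHypothesis.Theorems.WeilGroundStateGroundStatesConvergeToXiEnergySubexp
import HarnessLib

/-!
# Defective Grönwall transport: a transport law WITH DEFECT gives a floor, hence a zero-free strip
# (pub-rhpf, transport-1 gen 4, leaf G1.22 'TRANSPORT', track T-D; RH-free glue; def-free)

**mechanism/rigidity campaign; no RH claims.**  Companion text:
`run/shared/lean/pub/pub-rhpf/pub-rhpf-transport-1/TRANSPORT.md` §13.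

Setting (`Literature.NumberTheory.LFunctions`): `ε(a) = weilGroundEnergy a` is the bottom of Weil's form on the
window `[-a, a]`; the PROVED base gives the strict seed `0 < ε(a₀)` for `0 < a₀ < (log 3)/2`
(`weilGroundEnergy_pos_of_lt_log_three_half'`).

Every transport input of the leaf so far (`−ε′ ≤ K ε` in any form: `PfPersistenceTransport`, T-A/T-B) is
RH-strength: its conclusion is `ε > 0` at every window.  This file records the GRADED version.  A transport law
WITH DEFECT, in the route's derivative-free lower-right-Dini form,

  `ε(x) − ε(x + h) ≤ h · (K ε(x) + C e^{δ x} + η)`  for arbitrarily small `h > 0`  (`K ≥ 0` per compact range),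

no longer forces positivity; it forces a FLOOR `ε(a) ≥ −(C/δ) e^{δ a}` (the defect integrates, the rate term
only helps once `ε + (C/δ)e^{δ·}` is the transported quantity), and a floor of exponential rate `δ` is a
zero-free region `|Re ρ − 1/2| ≤ δ` by the tree's dictionary
`GroundStatesConvergeToXi.abs_re_sub_half_le_of_weilGroundEnergy_ge_neg_exp`.  So:

* `floor_of_defectiveDini` — real analysis: the Grönwall fence `WeilWindowFlowDiniLeakage.mul_exp_le_of_dini`
  applied to `f + Φ`, where `Φ ≥ 0` dominates the defect through the supporting-line condition
  `h · D(x) ≤ Φ(x + h) − Φ(x)`; conclusion `(f b + Φ b) e^{−K(x−b)} − Φ x ≤ f x`, in particular `−Φ x < f x`;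
* `floor_of_defectiveLeakageFrom` — for `ε` from ONE seed `a₀ < (log 3)/2` with defect `C e^{δ x}`:
  `−(C/δ) e^{δ a} ≤ ε(a)` for every `a > 0`;
* `strip_of_defectiveLeakageFrom` — hence every non-trivial zero has `|Re ρ − 1/2| ≤ δ` (quasi-RH of width `δ`;
  trivial for `δ ≥ 1/2`, RH-strength only in the limit `δ → 0`);
* `riemannHypothesis_of_defectiveLeakageFrom_all` — the defective law for EVERY `δ > 0` (constants `C_δ`) is
  RH (`riemannHypothesis_iff_weilGroundEnergy_subexp`); and the defect-free member `C = 0` is the leaf's T-A in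
  Dini form (`riemannHypothesis_of_diniLeakageFrom`: positivity at every window, hence RH).

The δ-family interpolates between T-A (δ → 0 / C = 0: RH-strength) and the empty statement (δ ≥ 1/2), and is
the first transport input of this leaf whose conclusion is STRICTLY WEAKER than RH for fixed δ ∈ (0, 1/2).
Nothing here is specific to ζ beyond the tree facts quoted; no converse (strip ⇒ defective law, RH ⇒ defective
law) is claimed; the strength of the class relative to RH is not decided here in either direction.
-/

noncomputable section

set_option linter.dupNamespace false  -- D-0017 nested layout: `RiemannHypothesis.RiemannHypothesis`

namespace Summit.RiemannHypothesis.RiemannHypothesis.Theorems.PfPersistenceDefectiveTransport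

open Set Filter Topology
open _root_.Literature.NumberTheory.LFunctions
open _root_.Summit.RiemannHypothesis.RiemannHypothesis.Theorems.WeilWindowFlowDiniLeakage
  (mul_exp_le_of_dini continuousOn_weilGroundEnergy_Icc)
open _root_.Summit.RiemannHypothesis.RiemannHypothesis.Theorems.GroundStatesConvergeToXi
  (abs_re_sub_half_le_of_weilGroundEnergy_ge_neg_exp riemannHypothesis_iff_weilGroundEnergy_subexp)
open _root_.Summit.RiemannHypothesis.RiemannHypothesis.Theorems.SpectralTraceWindowStep
  (weilGroundEnergy_pos_of_lt_log_three_half')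

/-! ## 0. Real analysis: the Grönwall fence with a dominated defect -/

/-- **Defective Grönwall fence.** Let `f` be continuous on `[b, c]`, `K ≥ 0`, and suppose the lower right Dini
slopes of `−f` obey `f x − f (x + h) ≤ h (K f x + D x + η)` for arbitrarily small `h > 0` at every `x ∈ [b, c)`
(the route's `η/δ/h` clause with a DEFECT `D`).  If `Φ ≥ 0` is continuous on `[b, c]` and dominates the defect
through the supporting-line condition `h · D x ≤ Φ (x + h) − Φ x` (`h > 0`), and `0 < f b + Φ b`, then
`(f b + Φ b) e^{−K (x − b)} − Φ x ≤ f x` on `[b, c]`: the transported quantity is `f + Φ`. [folklore] -/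
theorem floor_of_defectiveDini {f Φ D : ℝ → ℝ} {b c K : ℝ} (hK : 0 ≤ K)
    (hf : ContinuousOn f (Icc b c)) (hΦc : ContinuousOn Φ (Icc b c))
    (hΦ0 : ∀ x ∈ Icc b c, 0 ≤ Φ x)
    (hΦD : ∀ x ∈ Ico b c, ∀ h : ℝ, 0 < h → h * D x ≤ Φ (x + h) - Φ x)
    (hb : 0 < f b + Φ b)
    (hD : ∀ x ∈ Ico b c, ∀ η δ : ℝ, 0 < η → 0 < δ →
      ∃ h : ℝ, 0 < h ∧ h < δ ∧ f x - f (x + h) ≤ h * (K * f x + D x + η)) :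
    ∀ x ∈ Icc b c, (f b + Φ b) * Real.exp (-(K * (x - b))) - Φ x ≤ f x := by
  have key := mul_exp_le_of_dini (f := fun x ↦ f x + Φ x) (b := b) (c := c) (K := K)
    (hf.add hΦc) (by simpa using hb)
    (fun x hx η δ hη hδ ↦ by
      obtain ⟨h, hpos, hlt, hle⟩ := hD x hx η δ hη hδ
      refine ⟨h, hpos, hlt, ?_⟩
      have h1 : h * D x ≤ Φ (x + h) - Φ x := hΦD x hx h hpos
      have h2 : 0 ≤ h * (K * Φ x) := mul_nonneg hpos.le (mul_nonneg hK (hΦ0 x (Ico_subset_Icc_self hx)))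
      nlinarith)
  intro x hx
  have := key x hx
  linarith

/-- In particular the defect's dominating function is a FLOOR: `−Φ x < f x` on `[b, c]`. [folklore] -/
theorem neg_lt_of_defectiveDini {f Φ D : ℝ → ℝ} {b c K : ℝ} (hK : 0 ≤ K)
    (hf : ContinuousOn f (Icc b c)) (hΦc : ContinuousOn Φ (Icc b c))
    (hΦ0 : ∀ x ∈ Icc b c, 0 ≤ Φ x)
    (hΦD : ∀ x ∈ Ico b c, ∀ h : ℝ, 0 < h → h * D x ≤ Φ (x + h) - Φ x)
    (hb : 0 < f b + Φ b)
    (hD : ∀ x ∈ Ico b c, ∀ η δ : ℝ, 0 < η → 0 < δ →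
      ∃ h : ℝ, 0 < h ∧ h < δ ∧ f x - f (x + h) ≤ h * (K * f x + D x + η)) :
    ∀ x ∈ Icc b c, -Φ x < f x := by
  intro x hx
  have h1 := floor_of_defectiveDini hK hf hΦc hΦ0 hΦD hb hD x hx
  have h2 : 0 < (f b + Φ b) * Real.exp (-(K * (x - b))) := mul_pos hb (Real.exp_pos _)
  linarith

/-- The exponential defect `D x = C e^{δ x}` (`C ≥ 0`, `δ > 0`) is dominated by `Φ x = (C/δ) e^{δ x}`:
`h · C e^{δ x} ≤ (C/δ)(e^{δ (x + h)} − e^{δ x})` for `h > 0` (convexity: `1 + δ h ≤ e^{δ h}`). [folklore] -/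
theorem exp_defect_dominated {C δ : ℝ} (hC : 0 ≤ C) (hδ : 0 < δ) (x h : ℝ) (hh : 0 < h) :
    h * (C * Real.exp (δ * x)) ≤ C / δ * Real.exp (δ * (x + h)) - C / δ * Real.exp (δ * x) := by
  have h1 : δ * h + 1 ≤ Real.exp (δ * h) := by
    have := Real.add_one_le_exp (δ * h)
    linarith
  have h2 : Real.exp (δ * (x + h)) = Real.exp (δ * x) * Real.exp (δ * h) := by
    rw [mul_add, Real.exp_add]
  rw [h2]
  have h3 : 0 ≤ C / δ * Real.exp (δ * x) := by positivity
  have h4 : C / δ * Real.exp (δ * x) * (δ * h + 1) ≤ C / δ * Real.exp (δ * x) * Real.exp (δ * h) :=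
    mul_le_mul_of_nonneg_left h1 h3
  have h5 : C / δ * Real.exp (δ * x) * (δ * h) = h * (C * Real.exp (δ * x)) := by
    field_simp
  nlinarith [h4, h5, hh.le]

/-! ## 1. The window bottom: a defective transport law from ONE seed gives a floor, hence a strip -/

/-- **T-D (defective transport ⇒ floor).** If past a seed window `0 < a₀ < (log 3)/2` the window bottom obeys,
on every compact range `[a₀, A]` with some rate `K ≥ 0`, the DEFECTIVE leakage clause
`ε x − ε (x + h) ≤ h (K ε x + C e^{δ x} + η)` for arbitrarily small `h > 0` (`C ≥ 0`, `δ > 0`), then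
`−(C/δ) e^{δ a} ≤ ε(a)` for every `a > 0` (below the seed the PROVED base gives `ε > 0`).  CONDITIONAL
(the clause is the hypothesis); RH-free; no RH claim. [folklore] -/
theorem floor_of_defectiveLeakageFrom {a₀ C δ : ℝ} (ha₀ : 0 < a₀) (ha₀' : a₀ < Real.log 3 / 2)
    (hC : 0 ≤ C) (hδ : 0 < δ)
    (h : ∀ A : ℝ, a₀ ≤ A → ∃ K : ℝ, 0 ≤ K ∧ ∀ x ∈ Ico a₀ A, ∀ η δ' : ℝ, 0 < η → 0 < δ' →
      ∃ h : ℝ, 0 < h ∧ h < δ' ∧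
        weilGroundEnergy x - weilGroundEnergy (x + h) ≤
          h * (K * weilGroundEnergy x + C * Real.exp (δ * x) + η)) :
    ∀ a : ℝ, 0 < a → -(C / δ * Real.exp (δ * a)) ≤ weilGroundEnergy a := by
  intro a ha
  have hΦpos : 0 ≤ C / δ * Real.exp (δ * a) := by positivity
  by_cases hle : a ≤ a₀
  · have hpos : 0 < weilGroundEnergy a :=
      weilGroundEnergy_pos_of_lt_log_three_half' ha (lt_of_le_of_lt hle ha₀')
    linarith
  · have hlt : a₀ ≤ a := (lt_of_not_ge hle).le
    obtain ⟨K, hK, hKD⟩ := h a hlt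
    have hseed : 0 < weilGroundEnergy a₀ := weilGroundEnergy_pos_of_lt_log_three_half' ha₀ ha₀'
    have hb : 0 < weilGroundEnergy a₀ + C / δ * Real.exp (δ * a₀) := by positivity
    have hΦc : ContinuousOn (fun x ↦ C / δ * Real.exp (δ * x)) (Icc a₀ a) := by fun_prop
    have main := neg_lt_of_defectiveDini (f := weilGroundEnergy) (Φ := fun x ↦ C / δ * Real.exp (δ * x))
      (D := fun x ↦ C * Real.exp (δ * x)) (b := a₀) (c := a) (K := K) hK
      (continuousOn_weilGroundEnergy_Icc ha₀) hΦc (fun x _ ↦ by positivity)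
      (fun x _ hh hhpos ↦ exp_defect_dominated hC hδ x hh hhpos) hb hKD a ⟨hlt, le_rfl⟩
    exact main.le

/-- **T-D (defective transport ⇒ zero-free strip).** Under the hypotheses of `floor_of_defectiveLeakageFrom`
every non-trivial zero of `ζ` satisfies `|Re ρ − 1/2| ≤ δ` (tree dictionary
`abs_re_sub_half_le_of_weilGroundEnergy_ge_neg_exp`).  For fixed `δ ∈ (0, 1/2)` this is quasi-RH of width `δ`,
STRICTLY WEAKER than RH; for `δ ≥ 1/2` it is empty.  CONDITIONAL; RH-free; no RH claim. [folklore] -/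
theorem strip_of_defectiveLeakageFrom {a₀ C δ : ℝ} (ha₀ : 0 < a₀) (ha₀' : a₀ < Real.log 3 / 2)
    (hC : 0 ≤ C) (hδ : 0 < δ)
    (h : ∀ A : ℝ, a₀ ≤ A → ∃ K : ℝ, 0 ≤ K ∧ ∀ x ∈ Ico a₀ A, ∀ η δ' : ℝ, 0 < η → 0 < δ' →
      ∃ h : ℝ, 0 < h ∧ h < δ' ∧
        weilGroundEnergy x - weilGroundEnergy (x + h) ≤
          h * (K * weilGroundEnergy x + C * Real.exp (δ * x) + η))
    {ρ : ℂ} (hρ : ρ ∈ ZetaZeros.riemannZetaNontrivialZeros) : |ρ.re - 1 / 2| ≤ δ :=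
  abs_re_sub_half_le_of_weilGroundEnergy_ge_neg_exp (K := C / δ) (δ := δ) hδ.le
    (floor_of_defectiveLeakageFrom ha₀ ha₀' hC hδ h) hρ

/-- **The δ-family exhausts to RH.** If the defective leakage clause holds from the seed for EVERY rate
`δ > 0` (with its own constant `C_δ ≥ 0`), the floors are sub-exponential and RH follows
(`riemannHypothesis_iff_weilGroundEnergy_subexp`).  CONDITIONAL; no RH claim. [folklore] -/
theorem riemannHypothesis_of_defectiveLeakageFrom_all {a₀ : ℝ} (ha₀ : 0 < a₀) (ha₀' : a₀ < Real.log 3 / 2)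
    (h : ∀ δ : ℝ, 0 < δ → ∃ C : ℝ, 0 ≤ C ∧ ∀ A : ℝ, a₀ ≤ A → ∃ K : ℝ, 0 ≤ K ∧
      ∀ x ∈ Ico a₀ A, ∀ η δ' : ℝ, 0 < η → 0 < δ' →
        ∃ h : ℝ, 0 < h ∧ h < δ' ∧
          weilGroundEnergy x - weilGroundEnergy (x + h) ≤
            h * (K * weilGroundEnergy x + C * Real.exp (δ * x) + η)) :
    _root_.RiemannHypothesis := by
  refine riemannHypothesis_iff_weilGroundEnergy_subexp.2 fun δ hδ ↦ ?_
  obtain ⟨C, hC, hCD⟩ := h δ hδ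
  exact ⟨C / δ, floor_of_defectiveLeakageFrom ha₀ ha₀' hC hδ hCD⟩

/-- **The defect-free member is T-A in Dini form.** With `C = 0` the clause is the route's `DiniLeakage` seeded
at ONE window below `(log 3)/2` (instead of at every `b₀ > 0`), and the floor is `0`: `ε(a) > 0` at every window —
hence RH (`weilGroundEnergy_nonneg_iff_holds`, Yoshida `riemannHypothesis_iff_forall_weilPositivityOn`).
CONDITIONAL; no RH claim; recorded to show the δ-family interpolates between RH-strength (`C = 0`) and the empty
statement (`δ ≥ 1/2`). [folklore] -/
theorem riemannHypothesis_of_diniLeakageFrom {a₀ : ℝ} (ha₀ : 0 < a₀) (ha₀' : a₀ < Real.log 3 / 2)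
    (h : ∀ A : ℝ, a₀ ≤ A → ∃ K : ℝ, 0 ≤ K ∧ ∀ x ∈ Ico a₀ A, ∀ η δ' : ℝ, 0 < η → 0 < δ' →
      ∃ h : ℝ, 0 < h ∧ h < δ' ∧
        weilGroundEnergy x - weilGroundEnergy (x + h) ≤ h * (K * weilGroundEnergy x + η)) :
    _root_.RiemannHypothesis := by
  have hpos : ∀ a : ℝ, 0 < a → 0 < weilGroundEnergy a := by
    intro a ha
    by_cases hle : a ≤ a₀
    · exact weilGroundEnergy_pos_of_lt_log_three_half' ha (lt_of_le_of_lt hle ha₀')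
    · have hlt : a₀ ≤ a := (lt_of_not_ge hle).le
      obtain ⟨K, _, hKD⟩ := h a hlt
      have hseed : 0 < weilGroundEnergy a₀ := weilGroundEnergy_pos_of_lt_log_three_half' ha₀ ha₀'
      have fence := mul_exp_le_of_dini (f := weilGroundEnergy) (K := K)
        (continuousOn_weilGroundEnergy_Icc ha₀) hseed
        (fun x hx η δ' hη hδ' ↦ hKD x hx η δ' hη hδ') a ⟨hlt, le_rfl⟩
      exact lt_of_lt_of_le (mul_pos hseed (Real.exp_pos _)) fence
  exact riemannHypothesis_iff_forall_weilPositivityOn.2 fun a ha ↦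
    (weilGroundEnergy_nonneg_iff_holds ha).1 (hpos a ha).le

end Summit.RiemannHypothesis.RiemannHypothesis.Theorems.PfPersistenceDefectiveTransport

end
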